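import Summits.PneNP.PneNP.Theorems.SfmBlMachineDictDecomp

/-!
# Line «sfm-bl», MACHINE LAYER M5 dictionary (D2b): sparseness of the computed remainder (stmt-PneNP-20523)

FRONTIER F-N1c; nothing here bears on P vs NP.

Clause (sparse) of `SfmBl.cutCertified_of_pipeline` for the COMPUTED decomposition: for the machine's extraction
`extract γsq plegs (cands plegs cap t₀ u₁) u₂` (γsq = γ_sp² = 3600·(6000·2^60), `|u₁| = 2(t₀−1)` with a non-binding
cap, `|u₂| > 3m` rounds), every pair `(W₁, W₂)` of pieces that is connected for the pipeline's leg relation and has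
`|W₁| + |W₂| ≤ t₀` carries at most `γ_sp·√(|W₁||W₂|)` remainder legs.  Chain: D1b (connected pair ⟹ connected label
set of the same size) ⟹ M2c `exists_mem_cands` (it is a candidate) ⟹ M2c `eCount_sq_le_of_mem_cands` (the final
remainder fails the density test on it) ⟹ the count dictionary `eCount_eq_card_filter` (machine count = the
pipeline's `Finset` count) ⟹ p3's `sfmBl_sparse_of_not_dense_le`.
-/

set_option linter.dupNamespace false -- `Summit.PneNP.PneNP.…`: summit = sub-problem name (D-0017 single-conjunct layout)

namespace Summit.PneNP.PneNP.Theorems.SfmBlMachine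

open Literature.Computability.Complexity
open Summit.PneNP.PneNP.Theorems.Nc03AvoidResidualCoreCandFewHeadsRungFP (trips)
open Summit.PneNP.PneNP.Theorems.SfmBl (bipGraph)

variable {n m : ℕ}

/-! ## The machine's leg count of a candidate = the pipeline's count -/

/-- Length of a filter through indices. -/
theorem length_filter_eq_length_filter_range {α : Type} (p : α → Bool) (d : α) : ∀ l : List α,
    (l.filter p).length = ((List.range l.length).filter fun i => p (l.getD i d)).length
  | [] => by simp
  | x :: l => by
    have ih := length_filter_eq_length_filter_range p d l
    rw [List.length_cons, List.range_succ_eq_map, List.filter_cons, List.filter_cons]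
    have hmap : ((List.range l.length).map Nat.succ).filter (fun i => p ((x :: l).getD i d))
        = ((List.range l.length).filter fun i => p (l.getD i d)).map Nat.succ := by
      rw [List.filter_map]; congr 1
    by_cases h : p x = true
    · rw [if_pos h, List.getD_cons_zero, if_pos h, hmap, List.length_cons, List.length_cons, List.length_map, ih]
    · rw [if_neg h, List.getD_cons_zero, if_neg h, hmap, List.length_map, ih]

/-- The sides of a candidate built from a label set: its left side lists exactly the left pieces of `W₁`. -/
theorem mem_sidesOf_labelsOf {L : ℕ} {I : LocalMap 3 n m} (W₁ : Finset (LPiece L I)) (W₂ : Finset (RPiece L I))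
    {vis : List Lab} (hvis : vis.toFinset = labelsOf W₁ W₂) (i : LPiece L I) (k : RPiece L I) :
    (i.1 ∈ (sidesOf vis).1 ↔ i ∈ W₁) ∧ (k.1 ∈ (sidesOf vis).2 ↔ k ∈ W₂) := by
  constructor
  · rw [mem_sidesOf_fst, ← List.mem_toFinset, hvis, mem_labelsOf_left]
    exact ⟨fun h => h.1, fun h => ⟨h, LPiece.tag i⟩⟩
  · rw [mem_sidesOf_snd, ← List.mem_toFinset, hvis, mem_labelsOf_right]
    exact ⟨fun h => h.1, fun h => ⟨h, RPiece.tag k⟩⟩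

/-- The sides of such a candidate have `|W₁|` and `|W₂|` elements. -/
theorem length_sidesOf_labelsOf {L : ℕ} {I : LocalMap 3 n m} (W₁ : Finset (LPiece L I)) (W₂ : Finset (RPiece L I))
    {vis : List Lab} (hvis : vis.toFinset = labelsOf W₁ W₂) :
    (sidesOf vis).1.length = W₁.card ∧ (sidesOf vis).2.length = W₂.card := by
  classical
  obtain ⟨hn1, hn2⟩ := nodup_sidesOf vis
  constructor
  · rw [← List.toFinset_card_of_nodup hn1, ← Finset.card_image_of_injective W₁ Subtype.val_injective]
    congr 1
    ext P
    rw [List.mem_toFinset, mem_sidesOf_fst, ← List.mem_toFinset, hvis, Finset.mem_image]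
    constructor
    · rintro ⟨hP, h0⟩
      unfold labelsOf at hP
      rcases Finset.mem_union.1 hP with h | h
      · obtain ⟨i, hi, rfl⟩ := Finset.mem_image.1 h; exact ⟨i, hi, rfl⟩
      · obtain ⟨k, _, rfl⟩ := Finset.mem_image.1 h
        rw [RPiece.tag k] at h0; exact absurd h0 (by decide)
    · rintro ⟨i, hi, rfl⟩
      exact ⟨(mem_labelsOf_left W₁ W₂ i).2 hi, LPiece.tag i⟩
  · rw [← List.toFinset_card_of_nodup hn2, ← Finset.card_image_of_injective W₂ Subtype.val_injective]
    congr 1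
    ext P
    rw [List.mem_toFinset, mem_sidesOf_snd, ← List.mem_toFinset, hvis, Finset.mem_image]
    constructor
    · rintro ⟨hP, h1⟩
      unfold labelsOf at hP
      rcases Finset.mem_union.1 hP with h | h
      · obtain ⟨i, _, rfl⟩ := Finset.mem_image.1 h
        rw [LPiece.tag i] at h1; exact absurd h1 (by decide)
      · obtain ⟨k, hk, rfl⟩ := Finset.mem_image.1 h; exact ⟨k, hk, rfl⟩
    · rintro ⟨k, hk, rfl⟩
      exact ⟨(mem_labelsOf_right W₁ W₂ k).2 hk, RPiece.tag k⟩

/-- **COUNT DICTIONARY**: the machine's `eCount` of a candidate with label set `labelsOf W₁ W₂` is the pipeline's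
number of remainder legs from `W₁` to `W₂`. -/
theorem eCount_eq_card_filter (L : ℕ) (I : LocalMap 3 n m) (labels : List ℕ) (r : ℕ) (hlab : ∀ lab ∈ labels, lab ≤ r)
    (hlen : labels.length = 3 * m) (W₁ : Finset (LPiece L I)) (W₂ : Finset (RPiece L I))
    {vis : List Lab} (hvis : vis.toFinset = labelsOf W₁ W₂) :
    eCount (pieceLegs L (trips I)) labels (sidesOf vis)
      = (Finset.univ.filter fun e : Fin m × Fin 3 =>
          pM labels r hlab e = none ∧ srcM L I e ∈ W₁ ∧ dstM L I e ∈ W₂).card := by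
  classical
  unfold eCount
  have hzl : (labels.zip (pieceLegs L (trips I))).length = 3 * m := by
    rw [List.length_zip, hlen, length_pieceLegs, length_trips, min_self]
  rw [length_filter_eq_length_filter_range _ ((0 : ℕ), ((0, 0, 0, 0, 0, 0) : PLeg)), hzl]
  have hP : (Finset.univ.filter fun e : Fin m × Fin 3 => pM labels r hlab e = none ∧ srcM L I e ∈ W₁ ∧ dstM L I e ∈ W₂)
      = Finset.univ.filter fun e : Fin m × Fin 3 =>
          inPair (sidesOf vis) ((labels.zip (pieceLegs L (trips I))).getD (legIdx e) ((0 : ℕ), ((0, 0, 0, 0, 0, 0) : PLeg))) = true := by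
    refine Finset.filter_congr fun e _ => ?_
    have hi : legIdx e < labels.length := by rw [hlen]; exact legIdx_lt e
    have hp : legIdx e < (pieceLegs L (trips I)).length := by
      rw [length_pieceLegs, length_trips]; exact legIdx_lt e
    have hz : (labels.zip (pieceLegs L (trips I))).getD (legIdx e) ((0 : ℕ), ((0, 0, 0, 0, 0, 0) : PLeg))
        = (labels[legIdx e], plegOf L I e) := by
      rw [List.getD_eq_getElem _ _ (by rw [List.length_zip]; exact lt_min hi hp), List.getElem_zip, pieceLegs_getElem]
      rfl
    rw [hz, pM_eq_none_iff]
    unfold inPair labOf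
    rw [List.getD_eq_getElem _ _ hi]
    obtain ⟨h1, h2⟩ := mem_sidesOf_labelsOf W₁ W₂ hvis (srcM L I e) (dstM L I e)
    simp only [Bool.and_eq_true, decide_eq_true_eq]
    exact ⟨fun ⟨ha, hb, hc⟩ => ⟨ha, h1.2 hb, h2.2 hc⟩, fun ⟨ha, hb, hc⟩ => ⟨ha, h1.1 hb, h2.1 hc⟩⟩
  have h := card_filter_legIdx (m := m)
    (fun i => inPair (sidesOf vis) ((labels.zip (pieceLegs L (trips I))).getD i ((0 : ℕ), ((0, 0, 0, 0, 0, 0) : PLeg))) = true)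
  simp only [Bool.decide_eq_true] at h
  rw [hP]
  exact h.symm

/-! ## Clause (sparse) -/

/-- **Clause (sparse) for the COMPUTED decomposition.** -/
theorem sparse_pM {L : ℕ} (I : LocalMap 3 n m) (cap t₀ : ℕ) (u₁ : List Unit) (hu₁ : u₁.length = 2 * (t₀ - 1))
    (hcap : ∀ k, k ≤ u₁.length → (walksU (pieceLegs L (trips I)) k).length ≤ cap)
    (u₂ : List Unit) (hu₂ : (pieceLegs L (trips I)).length < u₂.length)
    (hlab : ∀ lab ∈ (extract (3600 * (6000 * 2 ^ 60)) (pieceLegs L (trips I))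
        (cands (pieceLegs L (trips I)) cap t₀ u₁) u₂).1,
      lab ≤ (extract (3600 * (6000 * 2 ^ 60)) (pieceLegs L (trips I)) (cands (pieceLegs L (trips I)) cap t₀ u₁) u₂).2)
    (W₁ : Finset (LPiece L I)) (W₂ : Finset (RPiece L I))
    (hconn : ((bipGraph (fun i k => ∃ e, srcM L I e = i ∧ dstM L I e = k)).induce
        {x | Sum.elim (fun i => i ∈ W₁) (fun k => k ∈ W₂) x}).Connected)
    (hsize : W₁.card + W₂.card ≤ t₀) :
    ((Finset.univ.filter fun e : Fin m × Fin 3 =>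
        pM _ _ hlab e = none ∧ srcM L I e ∈ W₁ ∧ dstM L I e ∈ W₂).card : ℝ)
      ≤ (60 * Real.sqrt (6000 * 2 ^ 60)) * Real.sqrt ((W₁.card : ℝ) * (W₂.card : ℝ)) := by
  classical
  -- empty sides are trivial
  by_cases h₁ : W₁ = ∅
  · refine SfmBl.sfmBl_sparse_of_side_empty (Finset.card_eq_zero.2 (Finset.filter_eq_empty_iff.2 ?_))
    intro e _ h; rw [h₁] at h; exact absurd h.2.1 (Finset.notMem_empty _)
  by_cases h₂ : W₂ = ∅
  · refine SfmBl.sfmBl_sparse_of_side_empty (Finset.card_eq_zero.2 (Finset.filter_eq_empty_iff.2 ?_))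
    intro e _ h; rw [h₂] at h; exact absurd h.2.2 (Finset.notMem_empty _)
  -- the label set is a connected set of pieces of size in [2, t₀]
  have hW₁ : 0 < W₁.card := Finset.card_pos.2 (Finset.nonempty_iff_ne_empty.2 h₁)
  have hW₂ : 0 < W₂.card := Finset.card_pos.2 (Finset.nonempty_iff_ne_empty.2 h₂)
  have hcardS := card_labelsOf W₁ W₂
  have hconn' := (connected_pipeline_iff_connected_labels L I W₁ W₂).1 hconn
  obtain ⟨W, hW, vis, hWvis, hvis⟩ := exists_mem_cands (pieceLegs L (trips I)) cap t₀ u₁ hu₁ hcap (labelsOf W₁ W₂)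
    (labelsOf_subset_pieces W₁ W₂) (by omega) (by omega) hconn'
  subst hWvis
  -- the final remainder fails the density test on this candidate
  have hle := eCount_sq_le_of_mem_cands (3600 * (6000 * 2 ^ 60)) (pieceLegs L (trips I))
    (cands (pieceLegs L (trips I)) cap t₀ u₁) u₂ hu₂ hW
  have hlen : (extract (3600 * (6000 * 2 ^ 60)) (pieceLegs L (trips I)) (cands (pieceLegs L (trips I)) cap t₀ u₁) u₂).1.length
      = 3 * m := by
    have := (extractInv_extract (3600 * (6000 * 2 ^ 60)) (pieceLegs L (trips I))
      (cands (pieceLegs L (trips I)) cap t₀ u₁) u₂).1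
    rw [length_pieceLegs, length_trips] at this; exact this
  obtain ⟨hl1, hl2⟩ := length_sidesOf_labelsOf W₁ W₂ hvis
  rw [hl1, hl2] at hle
  rw [← eCount_eq_card_filter L I _ _ hlab hlen W₁ W₂ hvis]
  exact SfmBl.sfmBl_sparse_of_not_dense_le (not_lt.2 hle) le_rfl

/-! ## The four decomposition clauses, bundled in the pipeline's shapes -/

/-- **THE COMPUTED DECOMPOSITION SATISFIES THE PIPELINE'S CLAUSES** (hsp, hsides, hdense, hcov of
`SfmBl.cutCertified_of_pipeline`, for `src := srcM L I`, `dst := dstM L I`, `r := st.2`, `p := pM st.1 st.2 _`,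
`V₁ := V₁M …`, `V₂ := V₂M …`, where `st` is the machine's extraction with γsq = γ_sp², candidates from `2(t₀−1)`
walk rounds under a non-binding cap, and more than `3m` extraction rounds). -/
theorem decomposition_clauses {L : ℕ} (I : LocalMap 3 n m) (cap t₀ : ℕ) (u₁ : List Unit)
    (hu₁ : u₁.length = 2 * (t₀ - 1))
    (hcap : ∀ k, k ≤ u₁.length → (walksU (pieceLegs L (trips I)) k).length ≤ cap)
    (u₂ : List Unit) (hu₂ : (pieceLegs L (trips I)).length < u₂.length) :
    let plegs := pieceLegs L (trips I)
    let st := extract (3600 * (6000 * 2 ^ 60)) plegs (cands plegs cap t₀ u₁) u₂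
    ∃ hlab : ∀ lab ∈ st.1, lab ≤ st.2,
      (∀ (W₁ : Finset (LPiece L I)) (W₂ : Finset (RPiece L I)),
        ((bipGraph (fun i k => ∃ e, srcM L I e = i ∧ dstM L I e = k)).induce
            {x | Sum.elim (fun i => i ∈ W₁) (fun k => k ∈ W₂) x}).Connected →
        W₁.card + W₂.card ≤ t₀ →
        ((Finset.univ.filter fun e : Fin m × Fin 3 =>
            pM st.1 st.2 hlab e = none ∧ srcM L I e ∈ W₁ ∧ dstM L I e ∈ W₂).card : ℝ)
          ≤ (60 * Real.sqrt (6000 * 2 ^ 60)) * Real.sqrt ((W₁.card : ℝ) * (W₂.card : ℝ))) ∧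
      (∀ (s : Fin st.2) (e : Fin m × Fin 3), pM st.1 st.2 hlab e = some s →
        srcM L I e ∈ V₁M L I st.1 st.2 hlab s ∧ dstM L I e ∈ V₂M L I st.1 st.2 hlab s) ∧
      (∀ s : Fin st.2, (60 * Real.sqrt (6000 * 2 ^ 60)) *
          Real.sqrt (((V₁M L I st.1 st.2 hlab s).card : ℝ) * ((V₂M L I st.1 st.2 hlab s).card : ℝ))
        < ((Finset.univ.filter fun e : Fin m × Fin 3 => pM st.1 st.2 hlab e = some s).card : ℝ)) ∧
      (∀ s : Fin st.2, (V₁M L I st.1 st.2 hlab s).card + (V₂M L I st.1 st.2 hlab s).card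
        ≤ 2 * (Finset.univ.filter fun e : Fin m × Fin 3 => pM st.1 st.2 hlab e = some s).card) := by
  intro plegs st
  have hI := extractInv_extract (3600 * (6000 * 2 ^ 60)) plegs (cands plegs cap t₀ u₁) u₂
  have hlen : st.1.length = 3 * m := by
    have := hI.1; rw [length_pieceLegs, length_trips] at this; exact this
  refine ⟨hI.2.1, fun W₁ W₂ hconn hsize => sparse_pM I cap t₀ u₁ hu₁ hcap u₂ hu₂ hI.2.1 W₁ W₂ hconn hsize,
    fun s e he => ⟨srcM_mem_V₁M L I st.1 st.2 hI.2.1 he, dstM_mem_V₂M L I st.1 st.2 hI.2.1 he⟩,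
    fun s => dense_V₁M_V₂M L I (cands plegs cap t₀ u₁) st hI.2.1 hlen
      (spotInv_extract (3600 * (6000 * 2 ^ 60)) plegs (cands plegs cap t₀ u₁) u₂) s,
    fun s => card_V₁M_add_card_V₂M_le L I st.1 st.2 hI.2.1 s⟩


end Summit.PneNP.PneNP.Theorems.SfmBlMachine
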